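import Literature.NumberTheory.EllipticCurves.TwoDescentOneRootKernel
import Literature.NumberTheory.EllipticCurves.MordellWeilModNCard
import HarnessLib

/-!
# The generic `2`-descent rank bound: `2^{rank E(F)} ≤ #μ(E(F))` for the Cassels map into `Lˣ/Lˣ²`
# (Cassels, *Lectures on Elliptic Curves*, §15: the weak finite basis theorem via `μ`)

Topic `NumberTheory/EllipticCurves`; sequel of `TwoDescentOneRoot.lean` (Cassels' map `μ : P ↦ x(P) − θ`, a
homomorphism, LMSST 24 §15 Lemma 1) and `TwoDescentOneRootKernel.lean` (its kernel is `2E(F)`, Lemma 2).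
Everything here is PROVED; no named fact, no `sorry`.

Setting: `W/F` elliptic (`char F = 0`), `L ⊇ F` a field, `θ ∈ L` a root of the `2`-division cubic `Ψ₂` with
`1, θ, θ²` linearly independent over `F` and every element of `L` a root of a monic cubic over `F` (i.e. `L = F(θ)`
the cubic `2`-division field of a curve with irreducible `Ψ₂`). Then:

* `algebraMap_ne_of_indep`, `not_isTwoTorsionX_of_indep`, `eq_zero_of_two_nsmul_eq_zero_of_indep` — `θ ∉ F`,
  `Ψ₂` has no root in `F`, and **`E(F)[2] = 0`** (a rational `2`-torsion point `(e, *)` would give `Ψ₂(e) = 0`, whence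
  `θ` would be a root of the complementary quadratic `4θ² + (4e + b₂)θ + (4e² + b₂e + 2b₄)` over `F`);
* **`ker_casselsMap_eq`** — `ker μ = 2E(F)` (Cassels §15 Lemma 2, assembled from `casselsMap_two_nsmul` and
  `exists_add_self_of_casselsMap_eq_zero`);
* **`pow_finrank_le_card_of_casselsMap_mem`** — if `E(F)` is finitely generated (Mordell–Weil) and `μ(E(F)) ⊆ T`
  for a finite set `T ⊆ Lˣ/Lˣ²`, then `2 ^ rank_ℤ E(F) ≤ #T`: `E(F)/2E(F) = E(F)/ker μ ≅ μ(E(F)) ⊆ T` and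
  `#(E(F)/2E(F)) = 2^{rank} · #E(F)[2] = 2^{rank}` (tree `natCard_quotient_nsmulRange_eq`);
  `pow_mordellWeilRank_le_card_of_casselsMap_mem` — the same for `WeierstrassCurve.mordellWeilRank`.

This is the rank half of the weak finite basis theorem by the generic `2`-descent (Cassels §15: "`μ(𝔊)` is finite,
`𝔊/2𝔊` is finite"); the arithmetic input — a finite `T`, in practice the classes of `L(S, 2)` with square norm —
is the part of the generic `2`-descent not yet in the tree.

## References

* [Cassels1991LecturesEllipticCurves] J. W. S. Cassels, *Lectures on Elliptic Curves*, LMSST 24 (1991), §15,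
  Lemmas 1–2 and the Theorem (weak finite basis theorem), pp. 42–44.
* [SilvermanAEC2009] J. H. Silverman, *The Arithmetic of Elliptic Curves*, 2nd ed. (2009), VIII.§1, Prop. X.1.4.
-/

noncomputable section

open scoped Classical

namespace WeierstrassCurve.Affine

variable {F : Type*} [Field F] [CharZero F] {W : Affine F}
variable {L : Type*} [Field L] [Algebra F L] {θ : L}

/-! ### `θ ∉ F` and `E(F)[2] = 0` from the independence of `1, θ, θ²` -/

omit [CharZero F] in
/-- `1, θ, θ²` independent over `F` ⟹ `θ ∉ F`. [cite: Cassels1991LecturesEllipticCurves, §15 (ℚ[Θ] a field)] -/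
theorem algebraMap_ne_of_indep
    (hind : ∀ p q r : F, algebraMap F L p + algebraMap F L q * θ + algebraMap F L r * θ ^ 2 = 0 →
      p = 0 ∧ q = 0 ∧ r = 0) (x : F) : algebraMap F L x ≠ θ := by
  intro h
  have := (hind x (-1) 0 (by rw [h, map_neg, map_one, map_zero]; ring)).2.1
  norm_num at this

/-- `1, θ, θ²` independent over `F` and `Ψ₂(θ) = 0` ⟹ `Ψ₂` has no root in `F` (otherwise `θ` is a root of the
complementary quadratic over `F`). [cite: Cassels1991LecturesEllipticCurves, §15 (ℚ[Θ] a field)] -/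
theorem not_isTwoTorsionX_of_indep (hθ : (W.baseChange L).toAffine.IsTwoTorsionX θ)
    (hind : ∀ p q r : F, algebraMap F L p + algebraMap F L q * θ + algebraMap F L r * θ ^ 2 = 0 →
      p = 0 ∧ q = 0 ∧ r = 0) (e : F) : ¬ W.IsTwoTorsionX e := by
  intro he
  have hb2 : (W.baseChange L).toAffine.b₂ = algebraMap F L W.b₂ := W.map_b₂ (algebraMap F L)
  have hb4 : (W.baseChange L).toAffine.b₄ = algebraMap F L W.b₄ := W.map_b₄ (algebraMap F L)
  have hb6 : (W.baseChange L).toAffine.b₆ = algebraMap F L W.b₆ := W.map_b₆ (algebraMap F L)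
  have hΨ := hθ.eq
  rw [hb2, hb4, hb6] at hΨ
  have heF := he.eq
  have heL : 4 * algebraMap F L e ^ 3 + algebraMap F L W.b₂ * algebraMap F L e ^ 2 +
      2 * algebraMap F L W.b₄ * algebraMap F L e + algebraMap F L W.b₆ = 0 := by
    have := congrArg (algebraMap F L) heF
    simpa only [map_add, map_mul, map_pow, map_ofNat, map_zero] using this
  have hne : θ - algebraMap F L e ≠ 0 := sub_ne_zero.mpr (algebraMap_ne_of_indep hind e).symm
  -- `Ψ₂(θ) − Ψ₂(e) = (θ − e) · (complementary quadratic at θ)`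
  have hquad : 4 * θ ^ 2 + (4 * algebraMap F L e + algebraMap F L W.b₂) * θ +
      (4 * algebraMap F L e ^ 2 + algebraMap F L W.b₂ * algebraMap F L e + 2 * algebraMap F L W.b₄) = 0 := by
    refine (mul_eq_zero.mp ?_).resolve_left hne
    linear_combination hΨ - heL
  have h4 := (hind (4 * e ^ 2 + W.b₂ * e + 2 * W.b₄) (4 * e + W.b₂) 4 (by
    simp only [map_add, map_mul, map_pow, map_ofNat]
    linear_combination hquad)).2.2
  norm_num at h4

/-- **`E(F)[2] = 0`** when `1, θ, θ²` are independent over `F` for a root `θ` of `Ψ₂`: a point with `2P = O`,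
`P ≠ O`, is `(e, y)` with `y = −y − a₁e − a₃`, so `Ψ₂(e) = (2y + a₁e + a₃)² = 0` with `e ∈ F`.
[cite: SilvermanAEC2009, Prop. III.2.3(d)] -/
theorem eq_zero_of_two_nsmul_eq_zero_of_indep (hθ : (W.baseChange L).toAffine.IsTwoTorsionX θ)
    (hind : ∀ p q r : F, algebraMap F L p + algebraMap F L q * θ + algebraMap F L r * θ ^ 2 = 0 →
      p = 0 ∧ q = 0 ∧ r = 0) (P : W.Point) (h2 : 2 • P = 0) : P = 0 := by
  rcases P with _ | ⟨x, y, hP⟩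
  · rfl
  · exfalso
    have hneg : Point.some x y hP = -Point.some x y hP := by
      rw [eq_neg_iff_add_eq_zero, ← two_nsmul]; exact h2
    rw [Point.neg_some, Point.some.injEq] at hneg
    have hy : 2 * y + W.a₁ * x + W.a₃ = 0 := by
      have := hneg.2; rw [negY] at this; linear_combination this
    apply not_isTwoTorsionX_of_indep hθ hind x
    refine ⟨?_⟩
    rw [twoDivision_eval_eq_sq_of_equation hP.1, hy]
    ring

/-- `#E(F)[2] = 1` under the same hypothesis. [cite: SilvermanAEC2009, Prop. III.2.3(d)] -/
theorem natCard_torsionBy_two_of_indep (hθ : (W.baseChange L).toAffine.IsTwoTorsionX θ)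
    (hind : ∀ p q r : F, algebraMap F L p + algebraMap F L q * θ + algebraMap F L r * θ ^ 2 = 0 →
      p = 0 ∧ q = 0 ∧ r = 0) :
    Nat.card (AddSubgroup.torsionBy W.Point ((2 : ℕ) : ℤ)) = 1 := by
  rw [Nat.card_eq_one_iff_unique]
  refine ⟨⟨fun a b ↦ ?_⟩, ⟨0⟩⟩
  have ha := eq_zero_of_two_nsmul_eq_zero_of_indep hθ hind (a : W.Point)
    (AddSubgroup.torsionBy.nsmul_iff.mp a.2)
  have hb := eq_zero_of_two_nsmul_eq_zero_of_indep hθ hind (b : W.Point)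
    (AddSubgroup.torsionBy.nsmul_iff.mp b.2)
  exact Subtype.ext (ha.trans hb.symm)

end WeierstrassCurve.Affine

namespace WeierstrassCurve

open Affine Affine.Point

variable {F : Type*} [Field F] [CharZero F] (V : WeierstrassCurve F) [V.IsElliptic]
variable (L : Type*) [Field L] [CharZero L] [Algebra F L] {θ : L} [(V.baseChange L).IsElliptic]

/-! ### `ker μ = 2E(F)` and the rank bound -/

/-- **`ker μ = 2E(F)`** for the Cassels map `μ : E(F) →+ Lˣ/Lˣ²` (Cassels §15 Lemma 2), under the standing
hypotheses on `(L, θ)` (`1, θ, θ²` independent; every element of `L` a root of a monic cubic over `F`).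
[cite: Cassels1991LecturesEllipticCurves, §15 Lemma 2] -/
theorem ker_casselsMap_eq (hθ : (V.baseChange L).toAffine.IsTwoTorsionX θ)
    (hind : ∀ p q r : F, algebraMap F L p + algebraMap F L q * θ + algebraMap F L r * θ ^ 2 = 0 →
      p = 0 ∧ q = 0 ∧ r = 0)
    (hcub : ∀ v : L, ∃ s₁ s₂ s₃ : F,
      v ^ 3 - algebraMap F L s₁ * v ^ 2 + algebraMap F L s₂ * v - algebraMap F L s₃ = 0) :
    (casselsMap (V := V) L hθ).ker =
      (nsmulAddMonoidHom 2 : V.toAffine.Point →+ V.toAffine.Point).range := by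
  ext P
  rw [AddMonoidHom.mem_ker, AddMonoidHom.mem_range]
  constructor
  · intro h0
    rcases P with _ | ⟨x, y, hP⟩
    · exact ⟨0, by rw [nsmulAddMonoidHom_apply, nsmul_zero]; rfl⟩
    · obtain ⟨Q, hQ⟩ := exists_add_self_of_casselsMap_eq_zero (W := V.toAffine) L hθ hind hcub hP
        (algebraMap_ne_of_indep hind x) h0
      exact ⟨Q, by rw [nsmulAddMonoidHom_apply, two_nsmul, hQ]⟩
  · rintro ⟨Q, rfl⟩
    rw [nsmulAddMonoidHom_apply]
    exact casselsMap_two_nsmul L hθ Q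

/-- **The generic `2`-descent rank bound** (Cassels §15, weak finite basis theorem through `μ`): if `E(F)` is finitely
generated and the Cassels map `μ : E(F) → Lˣ/Lˣ²` takes values in a finite set `T`, then `2 ^ rank_ℤ E(F) ≤ #T` — for
`E(F)/2E(F) = E(F)/ker μ` embeds into `T` and has `2^{rank} · #E(F)[2] = 2^{rank}` elements.
[cite: Cassels1991LecturesEllipticCurves, §15 Theorem (finite basis) with Lemmas 1–2] -/
theorem pow_finrank_le_card_of_casselsMap_mem [Module.Finite ℤ V.toAffine.Point]
    (hθ : (V.baseChange L).toAffine.IsTwoTorsionX θ)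
    (hind : ∀ p q r : F, algebraMap F L p + algebraMap F L q * θ + algebraMap F L r * θ ^ 2 = 0 →
      p = 0 ∧ q = 0 ∧ r = 0)
    (hcub : ∀ v : L, ∃ s₁ s₂ s₃ : F,
      v ^ 3 - algebraMap F L s₁ * v ^ 2 + algebraMap F L s₂ * v - algebraMap F L s₃ = 0)
    (T : Finset (Additive (SqUnits L))) (hT : ∀ P : V.toAffine.Point, casselsMap (V := V) L hθ P ∈ T) :
    2 ^ Module.finrank ℤ V.toAffine.Point ≤ T.card := by
  -- `#(E(F)/2E(F)) = 2 ^ rank`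
  have hcard : Nat.card (V.toAffine.Point ⧸
      (nsmulAddMonoidHom 2 : V.toAffine.Point →+ V.toAffine.Point).range) =
      2 ^ Module.finrank ℤ V.toAffine.Point := by
    rw [Literature.NumberTheory.EllipticCurves.natCard_quotient_nsmulRange_eq V.toAffine.Point 2,
      natCard_torsionBy_two_of_indep (W := V.toAffine) hθ hind, mul_one]
  -- `E(F)/2E(F) = E(F)/ker μ ↪ T` via `kerLift μ` (with `μ` generalised to an opaque homomorphism)
  have hker := ker_casselsMap_eq V L hθ hind hcub
  have hT' := hT
  generalize casselsMap (V := V) L hθ = μ at hker hT'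
  rw [← hker] at hcard
  have hg := QuotientAddGroup.kerLift_injective (G := V.toAffine.Point) (H := Additive (SqUnits L)) μ
  have hmk := QuotientAddGroup.kerLift_mk (G := V.toAffine.Point) (H := Additive (SqUnits L)) μ
  set g := QuotientAddGroup.kerLift (G := V.toAffine.Point) (H := Additive (SqUnits L)) μ
  have hmem : ∀ q : V.toAffine.Point ⧸ μ.ker, g q ∈ T := by
    intro q
    induction q using QuotientAddGroup.induction_on with
    | H P => rw [hmk]; exact hT' P
  let f : V.toAffine.Point ⧸ μ.ker → {t // t ∈ T} := fun q ↦ ⟨g q, hmem q⟩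
  have hf : Function.Injective f := fun a b h ↦
    hg (congrArg (fun t : {t // t ∈ T} ↦ (t : Additive (SqUnits L))) h)
  have hle := Nat.card_le_card_of_injective f hf
  rw [Nat.card_eq_finsetCard, hcard] at hle
  exact hle

/-- **Generic `2`-descent bound for the Mordell–Weil rank**: `2 ^ rank E(F) ≤ #T` whenever the Cassels map
`E(F) → Lˣ/Lˣ²` of the cubic `2`-division field `L = F(θ)` takes values in the finite set `T` (and `E(F)` is finitely
generated). [cite: Cassels1991LecturesEllipticCurves, §15 Theorem (finite basis) with Lemmas 1–2] -/
theorem pow_mordellWeilRank_le_card_of_casselsMap_mem [Module.Finite ℤ V.toAffine.Point]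
    (hθ : (V.baseChange L).toAffine.IsTwoTorsionX θ)
    (hind : ∀ p q r : F, algebraMap F L p + algebraMap F L q * θ + algebraMap F L r * θ ^ 2 = 0 →
      p = 0 ∧ q = 0 ∧ r = 0)
    (hcub : ∀ v : L, ∃ s₁ s₂ s₃ : F,
      v ^ 3 - algebraMap F L s₁ * v ^ 2 + algebraMap F L s₂ * v - algebraMap F L s₃ = 0)
    (T : Finset (Additive (SqUnits L)))
    (hT : ∀ P : V.toAffine.Point, casselsMap (V := V) L hθ P ∈ T) :
    2 ^ V.mordellWeilRank ≤ T.card :=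
  pow_finrank_le_card_of_casselsMap_mem V L hθ hind hcub T hT

end WeierstrassCurve

end
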